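import Literature.Analysis.PDE.TorusSymmHyperbolicLocalExistence
import HarnessLib

/-!
# [X_d] Single-datum smooth local existence for quasilinear symmetric hyperbolic systems on `𝕋ᵈ`

The named fact `SymmHyperbolicLocalExistenceDim d`: local `C^∞` existence for
`A₀(V)∂ₜV + ∑_{k<d} A_k(V)∂_kV = 0` on the flat torus `𝕋ᵈ = (ℝ/ℤ)ᵈ`, for ONE smooth datum with
compact range in the open domain `O` of the smooth matrix coefficients (`A₀` symmetric positive
definite, `A_k` symmetric) — literally the tree theorem
`Literature.Analysis.PDE.symmHyperbolicLocalExistence_matrix` with `Fin 3 ↦ Fin d` (existence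
only; no uniqueness, no continuation clause). KNOWN for every `d`: Kato 1975 Thm II (data in
`H^s`, `s > d/2 + 1`; `C^∞` data give `C^∞` solutions by persistence of regularity), Majda 1984
Thm 2.1, Rendall 2008 §8.3 pp. 178–183. In-tree PROVED for `d = 3` (rung
`symmHyperbolicLocalExistenceDim_three`, the faithfulness anchor of the definition); ABSENT for
`d ≠ 3` because one lemma of the quasilinear energy chain (the word-form Sobolev sup embedding
`exists_norm_sq_le_twordEnergy_two`, `H² ⊂ L^∞` with margin `2`) is typed at
`Fintype.card ι = 3` — its generic form is `Literature.Analysis.FunctionSpaces.Torus.WordSupEmbedding`.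
Users take `(h : SymmHyperbolicLocalExistenceDim d)`; the `d = 4` instance is the input of the
ParameterAsDimension door `Literature.Analysis.PDE.symmHyperbolic_smoothFamilies_of_dim4`
(`SymmHyperbolicSmoothFamiliesOfDim4`). Statement file (decomp-a2c lens-1 g43, critic row 571 (2)(ii)).

## References

* T. Kato, *The Cauchy problem for quasi-linear symmetric hyperbolic systems*, Arch. Rational
  Mech. Anal. 58 (1975) 181–205, Thm II. [`Kato1975`]
* A. Majda, *Compressible Fluid Flow and Systems of Conservation Laws in Several Space
  Variables*, Springer 1984, Thm 2.1. [`Majda1984`]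
* A. D. Rendall, *Partial Differential Equations in General Relativity*, OUP 2008, §8.3
  pp. 178–183. [`Rendall2008`]
-/

noncomputable section

open Set Filter Function Matrix Metric
open scoped ContDiff Topology

namespace Literature.Analysis.PDE

open Literature.Analysis.FunctionSpaces Literature.Analysis.FunctionSpaces.Torus

/-! ## [X_d] single-datum smooth local existence on `𝕋ᵈ` (matrix language) -/

/-- **[X_d]** Local `C^∞` existence for quasilinear symmetric hyperbolic systems
`A₀(V)∂ₜV + ∑_{k<d} A_k(V)∂_kV = 0` on the flat torus `𝕋ᵈ`, for ONE smooth datum with compact range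
in the (open) domain `O` of the smooth coefficients (`A₀` symmetric positive definite, `A_k`
symmetric). Literally `symmHyperbolicLocalExistence_matrix` with `Fin 3 ↦ Fin d`.
KNOWN for every `d` (Kato 1975 Thm II; Majda 1984 Thm 2.1; Rendall 2008 §8.3); in-tree PROVED for
`d = 3` only (`symmHyperbolicLocalExistenceDim_three`). Users take `(h : SymmHyperbolicLocalExistenceDim d)`.
[cite: Kato1975, Thm II] [cite: Majda1984, Thm 2.1] [cite: Rendall2008, §8.3 pp. 178–183] -/
def SymmHyperbolicLocalExistenceDim (d : ℕ) : Prop :=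
  ∀ (N : ℕ) (O : Set (EuclideanSpace ℝ (Fin N)))
    (A₀ : EuclideanSpace ℝ (Fin N) → Matrix (Fin N) (Fin N) ℝ)
    (A : Fin d → EuclideanSpace ℝ (Fin N) → Matrix (Fin N) (Fin N) ℝ),
    IsOpen O → (∀ i j, ContDiffOn ℝ ∞ (fun v => A₀ v i j) O) →
    (∀ k i j, ContDiffOn ℝ ∞ (fun v => A k v i j) O) →
    (∀ v ∈ O, (A₀ v).PosDef) → (∀ k, ∀ v ∈ O, (A k v).IsSymm) →
    ∀ V₀ : UnitAddTorus (Fin d) → EuclideanSpace ℝ (Fin N), IsSmooth V₀ →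
      (∃ K, IsCompact K ∧ K ⊆ O ∧ ∀ x, V₀ x ∈ K) →
      ∃ T : ℝ, 0 < T ∧ ∃ V : ℝ → UnitAddTorus (Fin d) → EuclideanSpace ℝ (Fin N),
        IsSmoothSpaceTimeOn (Ico 0 T) V ∧ V 0 = V₀ ∧ (∀ t ∈ Ico 0 T, ∀ x, V t x ∈ O) ∧
        ∀ t ∈ Ico 0 T, ∀ x,
          (A₀ (V t x)).mulVec (WithLp.ofLp (timeDerivWithin (Ico 0 T) V t x)) +
            ∑ k, (A k (V t x)).mulVec (WithLp.ofLp (partialDeriv k (V t) x)) = 0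

/-- Rung `d = 3` of [X_d]: the tree theorem `symmHyperbolicLocalExistence_matrix` (Kato's local
existence theorem on `𝕋³`, PROVED in `TorusSymmHyperbolicLocalExistence`). [cite: Kato1975, Thm II] -/
theorem symmHyperbolicLocalExistenceDim_three : SymmHyperbolicLocalExistenceDim 3 :=
  fun N O A₀ A hO hA0 hA hPD hSy V₀ hV₀ hK =>
    symmHyperbolicLocalExistence_matrix N O A₀ A hO hA0 hA hPD hSy V₀ hV₀ hK

end Literature.Analysis.PDE

end
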